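import Summits.Ventures.HSemireg.WedgeHankelRecurrenceKharitonovCubic
import Summits.Ventures.HSemireg.WedgeHankelRecurrenceHurwitzCoefficients

/-!
# Venture HSemireg — KHARITONOV'S THEOREM IN DEGREE 4 WITH THE ANDERSON–JURY–MANSOUR COUNT: **an interval family of real quartics `p = Σ_{k≤4} a_k X^k`, `l_k ≤ a_k ≤ u_k` (`0 < l_4`), is
# Hurwitz for every member iff `0 < l_0` and the TWO vertex polynomials `u_0 + l_1 X + l_2 X² + u_3 X³ + u_4 X⁴` and `u_0 + u_1 X + l_2 X² + l_3 X³ + u_4 X⁴` (two of Kharitonov's four) are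
# Hurwitz** — the quartic criterion `a_3 > 0, a_3a_2 − a_4a_1 > 0, (a_3a_2 − a_4a_1)a_1 − a_3²a_0 > 0, a_0 > 0` is monotone in `a_0, a_2, a_4` and, in `(a_1, a_3)`, the form
# `l_2 a_1a_3 − u_4 a_1² − u_0 a_3²` is concave in each variable separately, so its minimum over the rectangle sits at a vertex, and the two «diagonal» vertices dominate the other two

HONEST FRAMING. Part of the Lean index of the computation cell `pub-hsemireg` (seat p10 gen 41, Sunday typer «UNIFORM-IN-n»).  Elementary real inequalities on top of N216's explicit degree-4
Routh–Hurwitz criterion and N209's coefficient positivity; no variety, no cohomology theory, no sheaf, no Ext group and no semiregularity map is constructed here; nothing here says that HC / HC_CM /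
HC_AV holds; no Literature fact (unproved `Prop`) is declared or used.  Custodian versions as in `WedgeHankelSiegelIdeal` (1/3).
SOURCES (cited).  V. L. Kharitonov, Differ. Uravn. 14 (1978) 2086–2088; B. D. O. Anderson, E. I. Jury, M. Mansour, *On robust Hurwitz polynomials*, IEEE Trans. Automat. Control 32 (1987)
909–913 («for `n = 3, 4, 5` the number of Kharitonov polynomials to be tested can be reduced to one, two and three respectively»); N216 (`forall_re_neg_iff_of_natDegree_four`, HNW (13.13)).
PROOF TYPED HERE.  For a member, `a_3 ≥ l_3 > 0`, `a_3a_2 − a_4a_1 ≥ l_3l_2 − u_4u_1 > 0`, `a_0 ≥ l_0 > 0`, and `(a_3a_2 − a_4a_1)a_1 − a_3²a_0 ≥ φ(a_1, a_3)` with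
`φ(x, y) = l_2 xy − u_4 x² − u_0 y²`; `φ(x, y) ≥ min(φ(l_1, y), φ(u_1, y))` and the same in `y` (concavity: `φ(x,y) − φ(l_1,y) = (x − l_1)(l_2 y − u_4(x + l_1))`), and the «off-diagonal» vertex
values are positive as soon as the diagonal ones are: `u_3 φ(l_1,l_3) = l_3 φ(l_1,u_3) + (u_3 − l_3)(u_0u_3l_3 − u_4l_1²)`, `u_1 φ(l_1,l_3) = l_1 φ(u_1,l_3) + (u_1 − l_1)(u_4u_1l_1 − u_0l_3²)` (one of the
two brackets is nonnegative), and symmetrically for `φ(u_1, u_3)`.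
DEDUP DISCLOSURE (`rg -n 'natDegree_four|Kharitonov' Summits/Ventures/HSemireg`, 2026-09-02): N227 (`n = 2, 3`), N216 (the quartic criterion), N256∕N257 (general `n`, four polynomials).  The 6
names below: 0 hits in this namespace (`coeff_quartic` also names unrelated lemmas in other summits).

WHAT IS IN THE TREE.  N216 `forall_re_neg_iff_of_natDegree_four`; N209 `coeff_pos_of_forall_re_neg`; Mathlib `natDegree_cubic_le`, `natDegree_C_mul_X_pow`, `natDegree_add_eq_left_of_natDegree_lt`.
THIS FILE (namespace `Summit.Ventures.HSemireg.Wedge.HankelOuter` continued; CHAINED on N227 + N209; 0 definitions):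
* §1023 `natDegree_quartic_of_ne_zero`, `coeff_quartic` (bookkeeping), `biconcave_ge_vertex` (`φ(x,y) ≥` a vertex value on the rectangle), `biconcave_offdiag_pos` (diagonal vertices positive ⇒ all
  four positive), `biconcave_pos_of_diag` (⇒ `φ > 0` on the rectangle), **`forall_re_neg_box_iff_two_vertices_of_natDegree_four`** (the theorem).
CAVEATS.  `n = 5` (three polynomials) is not typed.  Nothing Ext-side.  New names only.
-/

open Module Polynomial
open scoped Matrix Polynomial

namespace Summit.Ventures.HSemireg.Wedge.HankelOuter

/-! ## §1023. Interval quartics: two vertex polynomials suffice -/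

/-- `deg (a_4X⁴ + a_3X³ + a_2X² + a_1X + a_0) = 4` for `a_4 ≠ 0`. [folklore; this file, §1023] -/
theorem natDegree_quartic_of_ne_zero {a4 a3 a2 a1 a0 : ℝ} (h4 : a4 ≠ 0) : (C a4 * X ^ 4 + C a3 * X ^ 3 + C a2 * X ^ 2 + C a1 * X + C a0 : ℝ[X]).natDegree = 4 := by
  have h : (C a4 * X ^ 4 + C a3 * X ^ 3 + C a2 * X ^ 2 + C a1 * X + C a0 : ℝ[X]) = C a4 * X ^ 4 + (C a3 * X ^ 3 + C a2 * X ^ 2 + C a1 * X + C a0) := by ring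
  rw [h, natDegree_add_eq_left_of_natDegree_lt] <;> rw [natDegree_C_mul_X_pow 4 a4 h4]
  exact lt_of_le_of_lt natDegree_cubic_le (by norm_num)

/-- Coefficients of `a_4X⁴ + a_3X³ + a_2X² + a_1X + a_0`. [folklore; this file, §1023] -/
theorem coeff_quartic (a4 a3 a2 a1 a0 : ℝ) :
    (C a4 * X ^ 4 + C a3 * X ^ 3 + C a2 * X ^ 2 + C a1 * X + C a0 : ℝ[X]).coeff 0 = a0 ∧ (C a4 * X ^ 4 + C a3 * X ^ 3 + C a2 * X ^ 2 + C a1 * X + C a0 : ℝ[X]).coeff 1 = a1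
      ∧ (C a4 * X ^ 4 + C a3 * X ^ 3 + C a2 * X ^ 2 + C a1 * X + C a0 : ℝ[X]).coeff 2 = a2 ∧ (C a4 * X ^ 4 + C a3 * X ^ 3 + C a2 * X ^ 2 + C a1 * X + C a0 : ℝ[X]).coeff 3 = a3
      ∧ (C a4 * X ^ 4 + C a3 * X ^ 3 + C a2 * X ^ 2 + C a1 * X + C a0 : ℝ[X]).coeff 4 = a4 := by
  simp [coeff_X, coeff_C, coeff_X_pow]

/-- **Concavity in each variable ⇒ a vertex bound**: for `φ(x, y) = c xy − a x² − b y²` with `a, b ≥ 0`, on the rectangle `l_1 ≤ x ≤ u_1`, `l_3 ≤ y ≤ u_3` the value `φ(x, y)` is at least one of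
the four vertex values. [Anderson–Jury–Mansour 1987, the mechanism for `n = 4`; this file, §1023] -/
theorem biconcave_ge_vertex {a b c l1 u1 l3 u3 x y : ℝ} (ha : 0 ≤ a) (hb : 0 ≤ b) (hx : l1 ≤ x ∧ x ≤ u1) (hy : l3 ≤ y ∧ y ≤ u3) :
    c * l1 * l3 - a * l1 ^ 2 - b * l3 ^ 2 ≤ c * x * y - a * x ^ 2 - b * y ^ 2 ∨ c * l1 * u3 - a * l1 ^ 2 - b * u3 ^ 2 ≤ c * x * y - a * x ^ 2 - b * y ^ 2
      ∨ c * u1 * l3 - a * u1 ^ 2 - b * l3 ^ 2 ≤ c * x * y - a * x ^ 2 - b * y ^ 2 ∨ c * u1 * u3 - a * u1 ^ 2 - b * u3 ^ 2 ≤ c * x * y - a * x ^ 2 - b * y ^ 2 := by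
  -- first move `x` to an endpoint, then `y`
  have stepx : ∀ y : ℝ, c * l1 * y - a * l1 ^ 2 - b * y ^ 2 ≤ c * x * y - a * x ^ 2 - b * y ^ 2 ∨ c * u1 * y - a * u1 ^ 2 - b * y ^ 2 ≤ c * x * y - a * x ^ 2 - b * y ^ 2 := by
    intro y
    rcases le_or_gt 0 (c * y - a * (x + l1)) with h | h
    · left; nlinarith [mul_nonneg (sub_nonneg.2 hx.1) h]
    · right; nlinarith [mul_nonneg (sub_nonneg.2 hx.2) (by nlinarith [mul_nonneg ha (sub_nonneg.2 hx.2)] : 0 ≤ a * (x + u1) - c * y)]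
  have stepy : ∀ x' : ℝ, c * x' * l3 - a * x' ^ 2 - b * l3 ^ 2 ≤ c * x' * y - a * x' ^ 2 - b * y ^ 2 ∨ c * x' * u3 - a * x' ^ 2 - b * u3 ^ 2 ≤ c * x' * y - a * x' ^ 2 - b * y ^ 2 := by
    intro x'
    rcases le_or_gt 0 (c * x' - b * (y + l3)) with h | h
    · left; nlinarith [mul_nonneg (sub_nonneg.2 hy.1) h]
    · right; nlinarith [mul_nonneg (sub_nonneg.2 hy.2) (by nlinarith [mul_nonneg hb (sub_nonneg.2 hy.2)] : 0 ≤ b * (y + u3) - c * x')]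
  rcases stepx y with h1 | h1
  · rcases stepy l1 with h2 | h2
    · exact Or.inl (h2.trans h1)
    · exact Or.inr (Or.inl (h2.trans h1))
  · rcases stepy u1 with h2 | h2
    · exact Or.inr (Or.inr (Or.inl (h2.trans h1)))
    · exact Or.inr (Or.inr (Or.inr (h2.trans h1)))

/-- **The two diagonal vertices dominate**: for `φ(x,y) = c xy − a x² − b y²` with `a, b > 0` and `0 < l_1 ≤ u_1`, `0 < l_3 ≤ u_3`: if `φ(l_1, u_3) > 0` and `φ(u_1, l_3) > 0` then also
`φ(l_1, l_3) > 0` and `φ(u_1, u_3) > 0`. [Anderson–Jury–Mansour 1987, `n = 4`; this file, §1023] -/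
theorem biconcave_offdiag_pos {a b c l1 u1 l3 u3 : ℝ} (ha : 0 < a) (hb : 0 < b) (hl1 : 0 < l1) (h1 : l1 ≤ u1) (hl3 : 0 < l3) (h3 : l3 ≤ u3)
    (hA : 0 < c * l1 * u3 - a * l1 ^ 2 - b * u3 ^ 2) (hB : 0 < c * u1 * l3 - a * u1 ^ 2 - b * l3 ^ 2) :
    0 < c * l1 * l3 - a * l1 ^ 2 - b * l3 ^ 2 ∧ 0 < c * u1 * u3 - a * u1 ^ 2 - b * u3 ^ 2 := by
  have hu1 : 0 < u1 := hl1.trans_le h1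
  have hu3 : 0 < u3 := hl3.trans_le h3
  constructor
  · -- `u_3 φ(l_1,l_3) = l_3 A + (u_3 − l_3)(b u_3 l_3 − a l_1²)`, `u_1 φ(l_1,l_3) = l_1 B + (u_1 − l_1)(a u_1 l_1 − b l_3²)`
    have e1 : u3 * (c * l1 * l3 - a * l1 ^ 2 - b * l3 ^ 2) = l3 * (c * l1 * u3 - a * l1 ^ 2 - b * u3 ^ 2) + (u3 - l3) * (b * u3 * l3 - a * l1 ^ 2) := by ring
    have e2 : u1 * (c * l1 * l3 - a * l1 ^ 2 - b * l3 ^ 2) = l1 * (c * u1 * l3 - a * u1 ^ 2 - b * l3 ^ 2) + (u1 - l1) * (a * u1 * l1 - b * l3 ^ 2) := by ring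
    rcases le_or_gt (b * l3 ^ 2) (a * u1 * l1) with hc | hc
    · have : 0 < u1 * (c * l1 * l3 - a * l1 ^ 2 - b * l3 ^ 2) := by
        rw [e2]; nlinarith [mul_nonneg (sub_nonneg.2 h1) (sub_nonneg.2 hc), mul_pos hl1 hB]
      exact (mul_pos_iff_of_pos_left hu1).1 this
    · have hpos : 0 < b * u3 * l3 - a * l1 ^ 2 := by nlinarith [mul_le_mul_of_nonneg_left h1 (mul_pos ha hl1).le, mul_le_mul_of_nonneg_left h3 (mul_pos hb hl3).le]
      have : 0 < u3 * (c * l1 * l3 - a * l1 ^ 2 - b * l3 ^ 2) := by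
        rw [e1]; nlinarith [mul_nonneg (sub_nonneg.2 h3) hpos.le, mul_pos hl3 hA]
      exact (mul_pos_iff_of_pos_left hu3).1 this
  · -- `l_3 φ(u_1,u_3) = u_3 B + (u_3 − l_3)(a u_1² − b u_3 l_3)`, `l_1 φ(u_1,u_3) = u_1 A + (u_1 − l_1)(b u_3² − a u_1 l_1)`
    have e1 : l3 * (c * u1 * u3 - a * u1 ^ 2 - b * u3 ^ 2) = u3 * (c * u1 * l3 - a * u1 ^ 2 - b * l3 ^ 2) + (u3 - l3) * (a * u1 ^ 2 - b * u3 * l3) := by ring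
    have e2 : l1 * (c * u1 * u3 - a * u1 ^ 2 - b * u3 ^ 2) = u1 * (c * l1 * u3 - a * l1 ^ 2 - b * u3 ^ 2) + (u1 - l1) * (b * u3 ^ 2 - a * u1 * l1) := by ring
    rcases le_or_gt (a * u1 * l1) (b * u3 ^ 2) with hc | hc
    · have : 0 < l1 * (c * u1 * u3 - a * u1 ^ 2 - b * u3 ^ 2) := by
        rw [e2]; nlinarith [mul_nonneg (sub_nonneg.2 h1) (sub_nonneg.2 hc), mul_pos hu1 hA]
      exact (mul_pos_iff_of_pos_left hl1).1 this
    · have hpos : 0 < a * u1 ^ 2 - b * u3 * l3 := by nlinarith [mul_le_mul_of_nonneg_left h1 (mul_pos ha hu1).le, mul_le_mul_of_nonneg_left h3 (mul_pos hb hu3).le]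
      have : 0 < l3 * (c * u1 * u3 - a * u1 ^ 2 - b * u3 ^ 2) := by
        rw [e1]; nlinarith [mul_nonneg (sub_nonneg.2 h3) hpos.le, mul_pos hu3 hB]
      exact (mul_pos_iff_of_pos_left hl3).1 this

/-- `φ > 0` on the whole rectangle as soon as it is positive at the two diagonal vertices (`a, b > 0`, `0 < l_1 ≤ u_1`, `0 < l_3 ≤ u_3`). [Anderson–Jury–Mansour 1987, `n = 4`; this file, §1023] -/
theorem biconcave_pos_of_diag {a b c l1 u1 l3 u3 x y : ℝ} (ha : 0 < a) (hb : 0 < b) (hl1 : 0 < l1) (hl3 : 0 < l3) (hx : l1 ≤ x ∧ x ≤ u1) (hy : l3 ≤ y ∧ y ≤ u3)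
    (hA : 0 < c * l1 * u3 - a * l1 ^ 2 - b * u3 ^ 2) (hB : 0 < c * u1 * l3 - a * u1 ^ 2 - b * l3 ^ 2) : 0 < c * x * y - a * x ^ 2 - b * y ^ 2 := by
  obtain ⟨hC, hD⟩ := biconcave_offdiag_pos ha hb hl1 (hx.1.trans hx.2) hl3 (hy.1.trans hy.2) hA hB
  rcases biconcave_ge_vertex ha.le hb.le hx hy (c := c) with h | h | h | h
  · exact hC.trans_le h
  · exact hA.trans_le h
  · exact hB.trans_le h
  · exact hD.trans_le h

/-- **KHARITONOV FOR QUARTICS WITH THE ANDERSON–JURY–MANSOUR COUNT: two vertex polynomials suffice.**  With `0 < l_4` and `l_k ≤ u_k`: EVERY real `p` of degree `4` with `l_k ≤ p_k ≤ u_k`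
(`k ≤ 4`) is Hurwitz iff `0 < l_0` and the two vertex polynomials `u_4X⁴ + u_3X³ + l_2X² + l_1X + u_0` and `u_4X⁴ + l_3X³ + l_2X² + u_1X + u_0` are Hurwitz.
[Kharitonov 1978; Anderson–Jury–Mansour 1987 (`n = 4`: two polynomials); N216; this file, §1023] -/
theorem forall_re_neg_box_iff_two_vertices_of_natDegree_four {l u : ℕ → ℝ} (hl4 : 0 < l 4) (hlu : ∀ k ≤ 4, l k ≤ u k) :
    (∀ p : ℝ[X], p.natDegree = 4 → (∀ k ≤ 4, l k ≤ p.coeff k ∧ p.coeff k ≤ u k) → ∀ z ∈ (p.map (algebraMap ℝ ℂ)).roots, z.re < 0)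
      ↔ 0 < l 0 ∧ (∀ z ∈ ((C (u 4) * X ^ 4 + C (u 3) * X ^ 3 + C (l 2) * X ^ 2 + C (l 1) * X + C (u 0) : ℝ[X]).map (algebraMap ℝ ℂ)).roots, z.re < 0)
        ∧ ∀ z ∈ ((C (u 4) * X ^ 4 + C (l 3) * X ^ 3 + C (l 2) * X ^ 2 + C (u 1) * X + C (u 0) : ℝ[X]).map (algebraMap ℝ ℂ)).roots, z.re < 0 := by
  have hu4 : 0 < u 4 := hl4.trans_le (hlu 4 le_rfl)
  -- membership of a vertex polynomial
  have hmem : ∀ a3 a2 a1 a0 : ℝ, (l 3 ≤ a3 ∧ a3 ≤ u 3) → (l 2 ≤ a2 ∧ a2 ≤ u 2) → (l 1 ≤ a1 ∧ a1 ≤ u 1) → (l 0 ≤ a0 ∧ a0 ≤ u 0) →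
      (C (u 4) * X ^ 4 + C a3 * X ^ 3 + C a2 * X ^ 2 + C a1 * X + C a0 : ℝ[X]).natDegree = 4
        ∧ ∀ k ≤ 4, l k ≤ (C (u 4) * X ^ 4 + C a3 * X ^ 3 + C a2 * X ^ 2 + C a1 * X + C a0 : ℝ[X]).coeff k
          ∧ (C (u 4) * X ^ 4 + C a3 * X ^ 3 + C a2 * X ^ 2 + C a1 * X + C a0 : ℝ[X]).coeff k ≤ u k := by
    intro a3 a2 a1 a0 h3 h2 h1 h0
    obtain ⟨c0, c1, c2, c3, c4⟩ := coeff_quartic (u 4) a3 a2 a1 a0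
    refine ⟨natDegree_quartic_of_ne_zero hu4.ne', fun k hk => ?_⟩
    interval_cases k
    · rw [c0]; exact h0
    · rw [c1]; exact h1
    · rw [c2]; exact h2
    · rw [c3]; exact h3
    · rw [c4]; exact ⟨hlu 4 le_rfl, le_rfl⟩
  constructor
  · intro H
    obtain ⟨hd1, hb1⟩ := hmem (u 3) (l 2) (l 1) (u 0) ⟨hlu 3 (by norm_num), le_rfl⟩ ⟨le_rfl, hlu 2 (by norm_num)⟩ ⟨le_rfl, hlu 1 (by norm_num)⟩ ⟨hlu 0 (by norm_num), le_rfl⟩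
    obtain ⟨hd2, hb2⟩ := hmem (l 3) (l 2) (u 1) (u 0) ⟨le_rfl, hlu 3 (by norm_num)⟩ ⟨le_rfl, hlu 2 (by norm_num)⟩ ⟨hlu 1 (by norm_num), le_rfl⟩ ⟨hlu 0 (by norm_num), le_rfl⟩
    obtain ⟨hd3, hb3⟩ := hmem (l 3) (l 2) (l 1) (l 0) ⟨le_rfl, hlu 3 (by norm_num)⟩ ⟨le_rfl, hlu 2 (by norm_num)⟩ ⟨le_rfl, hlu 1 (by norm_num)⟩ ⟨le_rfl, hlu 0 (by norm_num)⟩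
    refine ⟨?_, H _ hd1 hb1, H _ hd2 hb2⟩
    have h := (forall_re_neg_iff_of_natDegree_four hd3 (by rw [(coeff_quartic (u 4) (l 3) (l 2) (l 1) (l 0)).2.2.2.2]; exact hu4)).1 (H _ hd3 hb3)
    rw [(coeff_quartic (u 4) (l 3) (l 2) (l 1) (l 0)).1] at h
    exact h.2.2.2
  · rintro ⟨h0, K3, K4⟩ p hp hbox
    obtain ⟨c0, c1, c2, c3, c4⟩ := coeff_quartic (u 4) (u 3) (l 2) (l 1) (u 0)
    obtain ⟨d0, d1, d2, d3, d4⟩ := coeff_quartic (u 4) (l 3) (l 2) (u 1) (u 0)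
    -- positivity of the vertex coefficients
    have hposK3 := coeff_pos_of_forall_re_neg (p := (C (u 4) * X ^ 4 + C (u 3) * X ^ 3 + C (l 2) * X ^ 2 + C (l 1) * X + C (u 0) : ℝ[X]))
      (by rw [leadingCoeff, natDegree_quartic_of_ne_zero hu4.ne', c4]; exact hu4) K3
    have hposK4 := coeff_pos_of_forall_re_neg (p := (C (u 4) * X ^ 4 + C (l 3) * X ^ 3 + C (l 2) * X ^ 2 + C (u 1) * X + C (u 0) : ℝ[X]))
      (by rw [leadingCoeff, natDegree_quartic_of_ne_zero hu4.ne', d4]; exact hu4) K4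
    rw [natDegree_quartic_of_ne_zero hu4.ne'] at hposK3 hposK4
    have hl1 : 0 < l 1 := by have h := hposK3 1 (by norm_num); rwa [c1] at h
    have hl2 : 0 < l 2 := by have h := hposK3 2 (by norm_num); rwa [c2] at h
    have hl3 : 0 < l 3 := by have h := hposK4 3 (by norm_num); rwa [d3] at h
    have hu0 : 0 < u 0 := by have h := hposK3 0 (by norm_num); rwa [c0] at h
    -- the two vertex criteria
    have hK3 := (forall_re_neg_iff_of_natDegree_four (natDegree_quartic_of_ne_zero hu4.ne') (by rw [c4]; exact hu4)).1 K3
    have hK4 := (forall_re_neg_iff_of_natDegree_four (natDegree_quartic_of_ne_zero hu4.ne') (by rw [d4]; exact hu4)).1 K4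
    rw [c0, c1, c2, c3, c4] at hK3
    rw [d0, d1, d2, d3, d4] at hK4
    obtain ⟨-, -, hA, -⟩ := hK3
    obtain ⟨-, hB2, hB, -⟩ := hK4
    -- the member
    have h4p : 0 < p.coeff 4 := hl4.trans_le (hbox 4 le_rfl).1
    rw [forall_re_neg_iff_of_natDegree_four hp h4p]
    have b0 := hbox 0 (by norm_num)
    have b1 := hbox 1 (by norm_num)
    have b2 := hbox 2 (by norm_num)
    have b3 := hbox 3 (by norm_num)
    have b4 := hbox 4 le_rfl
    have ha1 : 0 < p.coeff 1 := hl1.trans_le b1.1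
    have ha3 : 0 < p.coeff 3 := hl3.trans_le b3.1
    have ha0 : 0 < p.coeff 0 := h0.trans_le b0.1
    have hA' : 0 < l 2 * l 1 * u 3 - u 4 * l 1 ^ 2 - u 0 * u 3 ^ 2 := by
      have e : l 2 * l 1 * u 3 - u 4 * l 1 ^ 2 - u 0 * u 3 ^ 2 = (u 3 * l 2 - u 4 * l 1) * l 1 - u 3 ^ 2 * u 0 := by ring
      rw [e]; exact hA
    have hB' : 0 < l 2 * u 1 * l 3 - u 4 * u 1 ^ 2 - u 0 * l 3 ^ 2 := by
      have e : l 2 * u 1 * l 3 - u 4 * u 1 ^ 2 - u 0 * l 3 ^ 2 = (l 3 * l 2 - u 4 * u 1) * u 1 - l 3 ^ 2 * u 0 := by ring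
      rw [e]; exact hB
    have hφ : 0 < l 2 * p.coeff 1 * p.coeff 3 - u 4 * p.coeff 1 ^ 2 - u 0 * p.coeff 3 ^ 2 :=
      biconcave_pos_of_diag hu4 hu0 hl1 hl3 b1 b3 hA' hB'
    refine ⟨ha3, ?_, ?_, ha0⟩
    · have f1 : l 3 * l 2 ≤ p.coeff 3 * p.coeff 2 := mul_le_mul b3.1 b2.1 hl2.le ha3.le
      have f2 : p.coeff 4 * p.coeff 1 ≤ u 4 * u 1 := mul_le_mul b4.2 b1.2 ha1.le hu4.le
      linarith
    · have f1 : l 2 * (p.coeff 3 * p.coeff 1) ≤ p.coeff 2 * (p.coeff 3 * p.coeff 1) := mul_le_mul_of_nonneg_right b2.1 (mul_pos ha3 ha1).le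
      have f2 : p.coeff 4 * p.coeff 1 ^ 2 ≤ u 4 * p.coeff 1 ^ 2 := mul_le_mul_of_nonneg_right b4.2 (sq_nonneg _)
      have f3 : p.coeff 0 * p.coeff 3 ^ 2 ≤ u 0 * p.coeff 3 ^ 2 := mul_le_mul_of_nonneg_right b0.2 (sq_nonneg _)
      nlinarith [f1, f2, f3, hφ]

end Summit.Ventures.HSemireg.Wedge.HankelOuter
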